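import Literature.MathematicalPhysics.QuantumFieldTheory.Balaban1983to89.B1Eq115GeneratingFunctional
import Literature.MathematicalPhysics.QuantumFieldTheory.Balaban1983to89.HiggsActionIntegrable

/-!
# `Balaban1983to89.B1Eq115GeneratingFunctionalPos` — T. Bałaban, *(Higgs)₂,₃ quantum fields in a finite volume. I*,
# Commun. Math. Phys. **85** (1982) 603–626 [Balaban1982Higgs1]: the generating functional Z^ε(J, f) of (1.15) p. 606
# is a CONVERGENT, STRICTLY POSITIVE integral for all sources (theorems only)

statement-level skeleton of published theorems with citation tags; proofs where landed; nothing here is a claim about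
the Yang–Mills mass gap

CITATION HEADER (lean-in-tree rule).  lit-balaban TYPED SKELETON, row `B1.Eq1.15` (owner r14; decl of record
`B1LowerBound.Ext115Printed`, concrete instance `B1Eq115GeneratingFunctional.sourceFamily` / `genFn`, typer g23
p328600); unit `lit-balaban-typer` gen 23.  RELATION TO THE TREE (nothing restated): `B1Eq115GeneratingFunctional`
defines `genFn D P J f = ∫dA∫dφ exp(−S^ε(A,φ) + ⟨J,A⟩ + ⟨f,φ⟩)` (the middle member of (1.15)) as a Lebesgue integral;
`HiggsActionIntegrable` (typer g3) proves that `exp(−S^ε)` is integrable and `Z^ε > 0` under the standing assumptions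
*"μ₀² > 0 and λ > 0"* (p. 605) for ANY real bare mass `m₀²`.  WHAT THIS MODULE ADDS (theorems only): the same two
facts WITH SOURCES — for every `J`, `f` the integrand of Z^ε(J, f) is integrable (`integrable_genFn_integrand`) and
`0 < Z^ε(J, f)` (`genFn_pos`, `sourceFamily_ZS_pos`), so the lower inequality of (1.15) is not vacuous and its
logarithm is defined (v1.1, typer g24, append-only: the same for an ARBITRARY vacuum counterterm `E₁` —
`genFnWith_pos`, `sourceFamilyWith_ZS_pos` — and for the REPAIRED reading `sourceFamilyR_ZS_pos`, `zRenR_pos`).  MECHANISM (ours, elementary; the print only says the integral defines a "generating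
functional"): absorb the linear source terms into half of the mass terms — `⟨J,A⟩ ≤ Σ_b η^d(μ₀²A_b²/4 + J_b²/μ₀²)`,
`⟨f,φ⟩ ≤ Σ_x η^d(|φ(x)|² + |f(x)|²/4)` (Cauchy–Schwarz + AM–GM) — and write `S^ε` with couplings `(m₀², λ, μ₀², E)`
as `S^ε` with couplings `(m₀² − 2, λ, μ₀²/2, E)` plus exactly these two positive quadratic terms
(`action_eq_action_shift_add`); the majorant `exp(const(J,f))·exp(−S^ε_{(m₀²−2, λ, μ₀²/2, E)})` is integrable by
`HiggsActionIntegrable.integrable_exp_neg_action` (which allows any real bare mass).  HONEST SCOPE: nothing of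
(1.15) itself (the two-sided bound with ε-independent E_∓) is asserted or proved here.
-/

namespace Literature.MathematicalPhysics.QuantumFieldTheory.Balaban1983to89.B1Eq115GeneratingFunctionalPos

open HiggsLattice B1Sect1Statements B1Eq115GeneratingFunctional MeasureTheory
open scoped BigOperators

section Absorb

variable {P : Params} {k N : ℕ}

/-- AM–GM in the form used to absorb a linear source term into a quadratic one:
`a·b ≤ κa² + b²/(4κ)` for `κ > 0`. [folklore] -/
private theorem mul_le_mul_sq_add_sq_div {κ : ℝ} (hκ : 0 < κ) (a b : ℝ) : a * b ≤ κ * a ^ 2 + b ^ 2 / (4 * κ) := by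
  have h0 : 0 ≤ (2 * κ * a - b) ^ 2 / (4 * κ) := by positivity
  have h : κ * a ^ 2 + b ^ 2 / (4 * κ) - a * b = (2 * κ * a - b) ^ 2 / (4 * κ) := by
    field_simp
    ring
  linarith

/-- The action (1.11) with couplings `(m₀², λ, μ₀², E)` IS the action with couplings `(m₀² − 2, λ, μ₀²/2, E)` plus
the two positive quadratic terms `Σ_b η^d (μ₀²/4) A_b²` and `Σ_x η^d |φ(x)|²` (bookkeeping identity; these two terms
are the room into which the source terms of (1.15) are absorbed). [cite: Balaban1982Higgs1, (1.11) p.605] -/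
theorem action_eq_action_shift_add (C : ChargeData N) (c : Couplings) (A : VecField P k) (φ : ScalarField P k N) :
    action C c A φ =
      action C ⟨c.m0sq - 2, c.lam, c.mu0sq / 2, c.E⟩ A φ
        + ∑ b : PBond P k, P.mesh k ^ P.d * (c.mu0sq / 4 * (A b) ^ 2)
        + ∑ x : Site P k, P.mesh k ^ P.d * ‖φ x‖ ^ 2 := by
  have hpot : potential c φ
      = potential (P := P) (k := k) ⟨c.m0sq - 2, c.lam, c.mu0sq / 2, c.E⟩ φ
          + ∑ x : Site P k, P.mesh k ^ P.d * ‖φ x‖ ^ 2 := by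
    unfold potential
    rw [← Finset.sum_add_distrib]
    refine Finset.sum_congr rfl fun x _ => ?_
    ring
  have hmass : (∑ b : PBond P k, P.mesh k ^ P.d * (c.mu0sq * (A b) ^ 2)) / 2
      = (∑ b : PBond P k, P.mesh k ^ P.d * (c.mu0sq / 2 * (A b) ^ 2)) / 2
          + ∑ b : PBond P k, P.mesh k ^ P.d * (c.mu0sq / 4 * (A b) ^ 2) := by
    rw [Finset.sum_div, Finset.sum_div, ← Finset.sum_add_distrib]
    refine Finset.sum_congr rfl fun b _ => ?_
    ring
  unfold action
  rw [hpot, add_div, hmass]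
  simp only [add_div]
  ring

/-- Absorption of the vector source: `⟨J, A⟩ ≤ Σ_b η^d (μ₀²A_b²/4 + J_b²/μ₀²)` for `μ₀² > 0` (scalar product (1.5);
Cauchy–Schwarz and AM–GM bondwise). [cite: Balaban1982Higgs1, (1.5) p.604] -/
theorem bondInner_le_absorb {mu0sq : ℝ} (hmu : 0 < mu0sq) (J A : VecField P k) :
    bondInner J A ≤ ∑ b : PBond P k, P.mesh k ^ P.d * (mu0sq / 4 * (A b) ^ 2)
        + ∑ b : PBond P k, P.mesh k ^ P.d * ((J b) ^ 2 / mu0sq) := by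
  unfold bondInner
  rw [← Finset.sum_add_distrib]
  refine Finset.sum_le_sum fun b _ => ?_
  rw [← mul_add]
  refine mul_le_mul_of_nonneg_left ?_ (pow_nonneg (P.mesh_pos k).le _)
  have h1 : inner ℝ (J b) (A b) ≤ ‖A b‖ * ‖J b‖ := by
    rw [mul_comm]; exact real_inner_le_norm (J b) (A b)
  have h2 := mul_le_mul_sq_add_sq_div (κ := mu0sq / 4) (by positivity) ‖A b‖ ‖J b‖
  have h3 : mu0sq / 4 * ‖A b‖ ^ 2 + ‖J b‖ ^ 2 / (4 * (mu0sq / 4)) = mu0sq / 4 * (A b) ^ 2 + (J b) ^ 2 / mu0sq := by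
    rw [Real.norm_eq_abs, Real.norm_eq_abs, sq_abs, sq_abs]
    ring
  linarith

/-- Absorption of the scalar source: `⟨f, φ⟩ ≤ Σ_x η^d (|φ(x)|² + |f(x)|²/4)` (scalar product (1.5); Cauchy–Schwarz
and AM–GM sitewise). [cite: Balaban1982Higgs1, (1.5) p.604] -/
theorem siteInner_le_absorb (f φ : ScalarField P k N) :
    siteInner f φ ≤ ∑ x : Site P k, P.mesh k ^ P.d * ‖φ x‖ ^ 2
        + ∑ x : Site P k, P.mesh k ^ P.d * (‖f x‖ ^ 2 / 4) := by
  unfold siteInner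
  rw [← Finset.sum_add_distrib]
  refine Finset.sum_le_sum fun x _ => ?_
  rw [← mul_add]
  refine mul_le_mul_of_nonneg_left ?_ (pow_nonneg (P.mesh_pos k).le _)
  have h1 : inner ℝ (f x) (φ x) ≤ ‖φ x‖ * ‖f x‖ := by
    rw [mul_comm]; exact real_inner_le_norm (f x) (φ x)
  have h2 := mul_le_mul_sq_add_sq_div (κ := (1 : ℝ)) one_pos ‖φ x‖ ‖f x‖
  have h3 : (1 : ℝ) * ‖φ x‖ ^ 2 + ‖f x‖ ^ 2 / (4 * 1) = ‖φ x‖ ^ 2 + ‖f x‖ ^ 2 / 4 := by ring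
  linarith

/-- The exponent of Z^ε(J, f) is dominated by a source-dependent constant minus the action with shifted couplings
`(m₀² − 2, λ, μ₀²/2, E)`. [cite: Balaban1982Higgs1, (1.15) p.606] -/
theorem exponent_le (C : ChargeData N) (c : Couplings) (hmu : 0 < c.mu0sq) (J A : VecField P k)
    (f φ : ScalarField P k N) :
    -action C c A φ + bondInner J A + siteInner f φ ≤
      (∑ b : PBond P k, P.mesh k ^ P.d * ((J b) ^ 2 / c.mu0sq)
          + ∑ x : Site P k, P.mesh k ^ P.d * (‖f x‖ ^ 2 / 4))
        - action C ⟨c.m0sq - 2, c.lam, c.mu0sq / 2, c.E⟩ A φ := by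
  have h1 := action_eq_action_shift_add C c A φ
  have h2 := bondInner_le_absorb hmu J A
  have h3 := siteInner_le_absorb f φ
  linarith

/-- The integrand of Z^ε(J, f) is continuous in `(A, φ)` (hence measurable). [cite: Balaban1982Higgs1, (1.15) p.606] -/
theorem continuous_exponent (C : ChargeData N) (c : Couplings) (J : VecField P k) (f : ScalarField P k N) :
    Continuous fun Φ : VecField P k × ScalarField P k N =>
      -action C c Φ.1 Φ.2 + bondInner J Φ.1 + siteInner f Φ.2 := by
  have hb : Continuous fun Φ : VecField P k × ScalarField P k N => bondInner J Φ.1 := by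
    unfold bondInner
    exact continuous_finsetSum _ fun b _ =>
      ((continuous_const.inner ((continuous_apply b).comp continuous_fst))).const_mul _
  have hs : Continuous fun Φ : VecField P k × ScalarField P k N => siteInner f Φ.2 := by
    unfold siteInner
    exact continuous_finsetSum _ fun x _ =>
      ((continuous_const.inner ((continuous_apply x).comp continuous_snd))).const_mul _
  exact ((HiggsActionIntegrable.continuous_action C c).neg.add hb).add hs

/-- **The integral Z^ε(J, f) of (1.15) converges**: `exp(−S^ε(A,φ) + ⟨J,A⟩ + ⟨f,φ⟩)` is integrable for `dA dφ`, for
every `J`, `f`, under the standing assumptions `μ₀² > 0`, `λ > 0` (any real bare mass, any `e`, any `E`). PROVED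
(absorption + typer g3's `integrable_exp_neg_action` at the shifted couplings). [cite: Balaban1982Higgs1, (1.15) p.606] -/
theorem integrable_exponent (C : ChargeData N) (c : Couplings) (hmu : 0 < c.mu0sq) (hlam : 0 < c.lam)
    (J : VecField P k) (f : ScalarField P k N) :
    Integrable fun Φ : VecField P k × ScalarField P k N =>
      Real.exp (-action C c Φ.1 Φ.2 + bondInner J Φ.1 + siteInner f Φ.2) := by
  set K : ℝ := ∑ b : PBond P k, P.mesh k ^ P.d * ((J b) ^ 2 / c.mu0sq)
      + ∑ x : Site P k, P.mesh k ^ P.d * (‖f x‖ ^ 2 / 4) with hK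
  have hmaj := (HiggsActionIntegrable.integrable_exp_neg_action (P := P) (k := k) C
      ⟨c.m0sq - 2, c.lam, c.mu0sq / 2, c.E⟩ (show 0 < c.mu0sq / 2 by positivity) hlam).const_mul (Real.exp K)
  refine hmaj.mono' ((Real.continuous_exp.comp (continuous_exponent C c J f)).measurable.aestronglyMeasurable)
    (Filter.Eventually.of_forall fun Φ => ?_)
  rw [Real.norm_eq_abs, abs_of_pos (Real.exp_pos _), ← Real.exp_add, Real.exp_le_exp]
  have h := exponent_le C c hmu J Φ.1 f Φ.2
  linarith

end Absorb

section Model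

variable (D : ModelData)

/-- the model's couplings have the model's `μ₀²` and `λ` (definitional). [cite: Balaban1982Higgs1, (1.11) p.605] -/
theorem couplings_mu0sq (P : Params) : (couplings D P).mu0sq = D.mu0sq := rfl

/-- (definitional) [cite: Balaban1982Higgs1, (1.11) p.605] -/
theorem couplings_lam (P : Params) : (couplings D P).lam = D.lam := rfl

/-- **The integrand of Z^ε(J, f) is integrable** at the model's renormalized couplings, for all sources, under
*"μ₀² > 0 and λ > 0"*. [cite: Balaban1982Higgs1, (1.15) p.606] -/
theorem integrable_genFn_integrand (hmu : 0 < D.mu0sq) (hlam : 0 < D.lam) (P : Params) (J : VecField P 0)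
    (f : ScalarField P 0 D.N) :
    Integrable fun Φ : VecField P 0 × ScalarField P 0 D.N =>
      Real.exp (-action D.C (couplings D P) Φ.1 Φ.2 + bondInner J Φ.1 + siteInner f Φ.2) :=
  integrable_exponent D.C (couplings D P) hmu hlam J f

/-- **`0 < Z^ε(J, f)`** for all sources `J`, `f` (integral of a positive integrable function against Lebesgue measure),
under *"μ₀² > 0 and λ > 0"* — the lower member of (1.15) is meaningful. [cite: Balaban1982Higgs1, (1.15) p.606] -/
theorem genFn_pos (hmu : 0 < D.mu0sq) (hlam : 0 < D.lam) (P : Params) (J : VecField P 0)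
    (f : ScalarField P 0 D.N) : 0 < genFn D P J f := by
  haveI : (volume : Measure (VecField P 0 × ScalarField P 0 D.N)).IsAddHaarMeasure :=
    Measure.prod.instIsAddHaarMeasure (volume : Measure (VecField P 0)) (volume : Measure (ScalarField P 0 D.N))
  unfold genFn
  exact integral_exp_pos (integrable_genFn_integrand D hmu hlam P J f)

/-- … in the words of the concrete source family: `0 < ZS` at every cutoff and every source.
[cite: Balaban1982Higgs1, (1.15) p.606] -/
theorem sourceFamily_ZS_pos (hmu : 0 < D.mu0sq) (hlam : 0 < D.lam) (P : {P : Params // D.Admissible P})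
    (s : (sourceFamily D).Src P) : 0 < (sourceFamily D).ZS P s :=
  genFn_pos D hmu hlam P.1 s.1 s.2

end Model

/-! ## v1.1 — the same facts for an ARBITRARY vacuum counterterm `E₁` and for the REPAIRED reading

(`B1Eq115GeneratingFunctional` v1.1: `couplingsWith`, `genFnWith`, `sourceFamilyWith`, `sourceFamilyR`; r01's
`B1Sect1Statements` v1.1: `zRenWith`, `e1R`; typer g24 `B1Eq113OneSidedDerivatives`).  Append-only. -/

section Generic

variable (D : ModelData)

/-- (definitional) [cite: Balaban1982Higgs1, (1.11) p.605] -/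
theorem couplingsWith_mu0sq (P : Params) (E₁ : ℝ) : (couplingsWith D P E₁).mu0sq = D.mu0sq := rfl

/-- (definitional) [cite: Balaban1982Higgs1, (1.11) p.605] -/
theorem couplingsWith_lam (P : Params) (E₁ : ℝ) : (couplingsWith D P E₁).lam = D.lam := rfl

/-- **The integrand of Z^ε(J, f) is integrable for EVERY vacuum counterterm `E₁`**, for all sources, under
*"μ₀² > 0 and λ > 0"*. [cite: Balaban1982Higgs1, (1.15) p.606] -/
theorem integrable_genFnWith_integrand (hmu : 0 < D.mu0sq) (hlam : 0 < D.lam) (P : Params) (E₁ : ℝ)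
    (J : VecField P 0) (f : ScalarField P 0 D.N) :
    Integrable fun Φ : VecField P 0 × ScalarField P 0 D.N =>
      Real.exp (-action D.C (couplingsWith D P E₁) Φ.1 Φ.2 + bondInner J Φ.1 + siteInner f Φ.2) :=
  integrable_exponent D.C (couplingsWith D P E₁) hmu hlam J f

/-- **`0 < Z^ε(J, f)` for EVERY vacuum counterterm `E₁`** and all sources, under *"μ₀² > 0 and λ > 0"*.
[cite: Balaban1982Higgs1, (1.15) p.606] -/
theorem genFnWith_pos (hmu : 0 < D.mu0sq) (hlam : 0 < D.lam) (P : Params) (E₁ : ℝ) (J : VecField P 0)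
    (f : ScalarField P 0 D.N) : 0 < genFnWith D P E₁ J f := by
  haveI : (volume : Measure (VecField P 0 × ScalarField P 0 D.N)).IsAddHaarMeasure :=
    Measure.prod.instIsAddHaarMeasure (volume : Measure (VecField P 0)) (volume : Measure (ScalarField P 0 D.N))
  unfold genFnWith
  exact integral_exp_pos (integrable_genFnWith_integrand D hmu hlam P E₁ J f)

/-- `0 < ZS` at every cutoff and every source of `sourceFamilyWith D E₁`. [cite: Balaban1982Higgs1, (1.15) p.606] -/
theorem sourceFamilyWith_ZS_pos (hmu : 0 < D.mu0sq) (hlam : 0 < D.lam) (E₁ : Params → ℝ)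
    (P : {P : Params // D.Admissible P}) (s : (sourceFamilyWith D E₁).Src P) :
    0 < (sourceFamilyWith D E₁).ZS P s :=
  genFnWith_pos D hmu hlam P.1 (E₁ P.1) s.1 s.2

/-- **REPAIRED READING: `0 < Z^ε(J, f)` at the repaired couplings (`E₁ = e1R`, one-sided (1.13))** for all sources —
the lower member of (1.15) at the repaired concrete source family `sourceFamilyR` is meaningful.
[cite: Balaban1982Higgs1, (1.15) p.606] -/
theorem sourceFamilyR_ZS_pos (hmu : 0 < D.mu0sq) (hlam : 0 < D.lam) (P : {P : Params // D.Admissible P})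
    (s : (sourceFamilyR D).Src P) : 0 < (sourceFamilyR D).ZS P s :=
  sourceFamilyWith_ZS_pos D hmu hlam D.e1R P s

/-- in particular r01's repaired `Z^ε = zRenR P` is `> 0` under *"μ₀² > 0 and λ > 0"*.
[cite: Balaban1982Higgs1, (1.10) p.605] -/
theorem zRenR_pos (hmu : 0 < D.mu0sq) (hlam : 0 < D.lam) (P : Params) : 0 < D.zRenR P := by
  rw [ModelData.zRenR_eq_zRenWith, ← genFnWith_zero_zero D P (D.e1R P)]
  exact genFnWith_pos D hmu hlam P (D.e1R P) 0 0

end Generic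

end Literature.MathematicalPhysics.QuantumFieldTheory.Balaban1983to89.B1Eq115GeneratingFunctionalPos
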